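import Mathlib.Data.Fintype.BigOperators
import Literature.Computability.Complexity.SumOfSquaresRefutation
import Literature.RingTheory.MvPolynomial.IteratedDerivations
import HarnessLib

/-!
# Degree-bounded sum-of-squares certificates modulo a polynomial system, and their transport

`HasSOSCertificate S p d`: the polynomial `p` has a STATIC SUM-OF-SQUARES CERTIFICATE of
half-degree `d` from the equations `S e = 0`,
`p = Σ_l q_l² + Σ_e g_e · S e` with `deg q_l ≤ d`, `deg (g_e · S e) ≤ 2d`
— the "degree-`2d` sos proof of `p ≥ 0` from `𝒫`" of Braun–Brown-Cohen–Huq–Pokutta–Raghavendra–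
Roy–Weitz–Zink (*The matching problem has no small symmetric SDP*, Math. Program. 165 (2017),
§2 / §4.2: "`f` has a sos proof of degree `d` from `𝒫` if `f = Σ_i h_i² + Σ_j g_j p_j` …") and of
Lee–Raghavendra–Steurer 2015, Def. 1.10. The tree's refutations `HasSOSRefutation S d`
(`SumOfSquaresRefutation.lean`) are LITERALLY the case `p = -1` (`hasSOSRefutation_iff`, `Iff.rfl`).

Main lemma (`HasSOSCertificate.map`): certificates TRANSPORT along an algebra homomorphism
`ψ : K[X_σ] → K[X_τ]` that does not raise total degrees and sends every equation `S e` either to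
`0` or to an equation `S' e'` of a second system — the substitution/restriction step behind
every "reduction" between SOS lower bounds (BBCHPRRWZ §4.5, p. 10: "we define `𝓕'` by
substituting …, which maps `𝒫_n` into `𝒫_{n'} ∪ {0}` and does not increase degrees"; Grigoriev
2001, Lemma 9). In particular (`map_aeval_of_totalDegree_le_one`) along substitutions of the
variables by polynomials of degree `≤ 1` (variables and constants).

## References

* G. Braun, J. Brown-Cohen, A. Huq, S. Pokutta, P. Raghavendra, A. Roy, B. Weitz, D. Zink,
  *The matching problem has no small symmetric SDP*, Math. Program. 165 (2017), §2, §4.2, §4.5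
  (arXiv:1504.00703). [BraunEtAl2016]
* J. R. Lee, P. Raghavendra, D. Steurer, *Lower bounds on the size of semidefinite programming
  relaxations*, STOC 2015, Def. 1.10. [LeeRaghavendraSteurer2015]
-/

noncomputable section

open MvPolynomial Finset

namespace Literature.Computability.Complexity

variable {ι κ σ τ K : Type*} [CommRing K]

/-- **Degree-bounded SOS certificate** of `p` modulo `S = 0`, half-degree `d`:
`p = Σ_l q_l² + Σ_e g_e · S e`, `deg q_l ≤ d`, `deg (g_e · S e) ≤ 2d`.
[cite: BraunEtAl2016, §2 ("f has a sos proof of degree d from 𝒫")] -/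
def HasSOSCertificate [Fintype ι] (S : ι → MvPolynomial σ K) (p : MvPolynomial σ K) (d : ℕ) :
    Prop :=
  ∃ (m : ℕ) (q : Fin m → MvPolynomial σ K) (g : ι → MvPolynomial σ K),
    (∀ l, (q l).totalDegree ≤ d) ∧ (∀ e, (g e * S e).totalDegree ≤ 2 * d) ∧
      (∑ l, q l * q l) + ∑ e, g e * S e = p

/-- A static SOS refutation is a certificate of `-1` (definitionally).
[cite: BraunEtAl2016, §2 ("a sos refutation of 𝒫: an sos proof for −1 ≥ 0 from 𝒫")] -/
theorem hasSOSRefutation_iff [Fintype ι] (S : ι → MvPolynomial σ K) (d : ℕ) :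
    HasSOSRefutation S d ↔ HasSOSCertificate S (-1) d :=
  Iff.rfl

/-- Monotonicity in the degree bound. [cite: BraunEtAl2016, §2] -/
theorem HasSOSCertificate.mono [Fintype ι] {S : ι → MvPolynomial σ K} {p : MvPolynomial σ K}
    {d d' : ℕ} (h : HasSOSCertificate S p d) (hd : d ≤ d') : HasSOSCertificate S p d' := by
  obtain ⟨m, q, g, hq, hg, hsum⟩ := h
  exact ⟨m, q, g, fun l => (hq l).trans hd, fun e => (hg e).trans (Nat.mul_le_mul_left 2 hd), hsum⟩

/-- Every equation has a certificate of half-degree `⌈deg / 2⌉`: `S e = 0 + 1 · S e`.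
[cite: BraunEtAl2016, §2] -/
theorem HasSOSCertificate.of_eq [Fintype ι] [DecidableEq ι] (S : ι → MvPolynomial σ K) (e : ι)
    {d : ℕ} (hd : (S e).totalDegree ≤ 2 * d) : HasSOSCertificate S (S e) d := by
  refine ⟨0, Fin.elim0, fun e' => if e' = e then 1 else 0, fun l => l.elim0, fun e' => ?_, ?_⟩
  · by_cases h : e' = e
    · subst h; simpa using hd
    · simp [h]
  · simp

/-- **Transport of certificates along an algebra homomorphism** that does not raise total
degrees and maps each equation of `S` to `0` or to an equation of `S'`: a certificate of `p` from
`S` becomes a certificate of `ψ p` from `S'` of the same half-degree (apply `ψ` and regroup the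
ideal part by target equation). [cite: BraunEtAl2016, §4.5 (p. 10, the substitution 𝓕 ↦ 𝓕')] -/
theorem HasSOSCertificate.map [Fintype ι] [Fintype κ] {S : ι → MvPolynomial σ K}
    {S' : κ → MvPolynomial τ K} (ψ : MvPolynomial σ K →ₐ[K] MvPolynomial τ K)
    (hdeg : ∀ p, (ψ p).totalDegree ≤ p.totalDegree)
    (hS : ∀ e, ψ (S e) = 0 ∨ ∃ e', ψ (S e) = S' e') {p : MvPolynomial σ K} {d : ℕ}
    (h : HasSOSCertificate S p d) : HasSOSCertificate S' (ψ p) d := by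
  classical
  obtain ⟨m, q, g, hq, hg, hsum⟩ := h
  have key : ∀ e, ∃ o : Option κ, ψ (S e) = o.elim 0 S' := fun e =>
    (hS e).elim (fun h0 => ⟨none, by simpa using h0⟩) fun ⟨e', he'⟩ => ⟨some e', by simpa using he'⟩
  choose T hT using key
  refine ⟨m, fun l => ψ (q l), fun e' => ∑ e ∈ univ.filter (fun e => T e = some e'), ψ (g e),
    fun l => (hdeg _).trans (hq l), fun e' => ?_, ?_⟩
  · rw [sum_mul]
    refine (totalDegree_finsetSum _ _).trans (Finset.sup_le fun e he => ?_)
    have hTe : T e = some e' := (mem_filter.1 he).2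
    have hSe : ψ (S e) = S' e' := by rw [hT e, hTe]; rfl
    rw [← hSe, ← map_mul]
    exact (hdeg _).trans (hg e)
  · have himg := congrArg ψ hsum
    rw [map_add, map_sum, map_sum] at himg
    rw [← himg]
    congr 1
    · exact sum_congr rfl fun l _ => (map_mul _ _ _).symm
    · -- regroup `Σ_e ψ(g e) ψ(S e)` by the target index `T e`
      have hfib : ∑ e, ψ (g e * S e) =
          ∑ o : Option κ, ∑ e ∈ univ.filter (fun e => T e = o), ψ (g e * S e) :=
        (sum_fiberwise univ T fun e => ψ (g e * S e)).symm
      rw [hfib, Fintype.sum_option]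
      have h0 : ∑ e ∈ univ.filter (fun e => T e = none), ψ (g e * S e) = 0 := by
        refine sum_eq_zero fun e he => ?_
        rw [map_mul, hT e, (mem_filter.1 he).2]
        simp
      rw [h0, zero_add]
      refine sum_congr rfl fun e' _ => ?_
      rw [sum_mul]
      refine sum_congr rfl fun e he => ?_
      rw [map_mul, hT e, (mem_filter.1 he).2]
      rfl

/-- **Transport along a substitution of degree `≤ 1`** (variables ↦ variables or constants, as in
BBCHPRRWZ §4.5): if every `f x` has total degree `≤ 1` and the substitution maps each equation of
`S` to `0` or to an equation of `S'`, certificates of half-degree `d` from `S` go to certificates of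
half-degree `d` from `S'`. [cite: BraunEtAl2016, §4.5 (p. 10)] -/
theorem HasSOSCertificate.map_aeval_of_totalDegree_le_one [Fintype ι] [Fintype κ]
    {S : ι → MvPolynomial σ K} {S' : κ → MvPolynomial τ K} (f : σ → MvPolynomial τ K)
    (hf : ∀ x, (f x).totalDegree ≤ 1)
    (hS : ∀ e, aeval f (S e) = 0 ∨ ∃ e', aeval f (S e) = S' e') {p : MvPolynomial σ K} {d : ℕ}
    (h : HasSOSCertificate S p d) : HasSOSCertificate S' (aeval f p) d :=
  h.map (aeval f) (Literature.RingTheory.MvPolynomial.totalDegree_aeval_le_of_le_one f hf) hS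

/-- In particular for refutations: if moreover `aeval f p = -1` for some `p` certified from `S`
(e.g. `p = -1` itself), then `S'` is refutable in the same half-degree.
[cite: BraunEtAl2016, §4.5 (p. 10)] -/
theorem HasSOSCertificate.hasSOSRefutation_of_aeval_eq [Fintype ι] [Fintype κ]
    {S : ι → MvPolynomial σ K} {S' : κ → MvPolynomial τ K} (f : σ → MvPolynomial τ K)
    (hf : ∀ x, (f x).totalDegree ≤ 1)
    (hS : ∀ e, aeval f (S e) = 0 ∨ ∃ e', aeval f (S e) = S' e') {p : MvPolynomial σ K} {d : ℕ}
    (h : HasSOSCertificate S p d) (hp : aeval f p = -1) : HasSOSRefutation S' d := by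
  rw [hasSOSRefutation_iff, ← hp]
  exact h.map_aeval_of_totalDegree_le_one f hf hS

end Literature.Computability.Complexity
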